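import Summits.ValiantsHypothesis.ValiantsHypothesis.Theorems.NewtonFramesTwoProductsFrameRungTwoFaceGeometry

/-!
# Crux `TwoProducts` (stmt-5906), line `FrameRungTwo`: STUB 2 `stub_faceCount` (verbatim)

Crux `TwoProducts` (stmt-ValiantsHypothesis-5906), registered forward line `Cruxes/TwoProducts/Lines/FrameRungTwo.lean`
(rung `FrameRungTwo`), STUB 2 `stub_faceCount` ("provable; planar convex geometry"): the CROSS-FREE vertices of
`conv X` — strictly exposed in `X ⊆ Y₀ ∪ Y₁` by a functional under which no point of `Y₀ ∪ Y₁` lies higher — number at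
most `2 (vert Y₀ + vert Y₁)`.  STUB 1 `stub_classHull` is landed (`…FrameRungTwoClassHull.lean`); STUB 3
`stub_crossCancelCount` is the OPEN core of the rung.  Nothing here bears on the crux `TwoProducts` or on `VP ≠ VNP`.

Proof: let `Y = Y₀ ∪ Y₁`, `V` = vertices of `conv Y` (`V ⊆ vert Y₀ ∪ vert Y₁`).  A cross-free point `p` with functional
`l` maximises `l` over `Y`; the lexicographic extremes `a, b` of the top face `{y ∈ Y : l y = l p}` are vertices of
`conv Y` (`lexmax_mem_extremePoints`); if `p ∉ V` then `a ≠ b`, and the pair `{a, b}` determines `p` (two functionals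
vanishing on `a - b` are parallel; strict exposure).  Every vertex `v` lies in at most two such pairs
(`three_directions_absurd` on the directions to the other endpoints, after excluding collinear configurations by
extremality), so by double counting (`card_le_of_edges`) the cross-free non-vertices number `≤ #V`, and the cross-free
vertices trivially `≤ #V`.  [folklore]
-/

set_option linter.dupNamespace false
set_option linter.unusedSimpArgs false

namespace Summit.ValiantsHypothesis.ValiantsHypothesis.Theorems.NewtonFramesTwoProducts.FrameRungTwoFaceCount

open scoped BigOperators

noncomputable section

/-! ## Part 2. The stub -/

/-- Double counting: if every `p ∈ S` carries a 2-element subset `edge p ⊆ W` and every `w ∈ W` lies in at most two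
of them, then `#S ≤ #W`. -/
theorem card_le_of_edges {E : Type*} [DecidableEq E] (S W : Finset E) (edge : E → Finset E)
    (hsub : ∀ p ∈ S, edge p ⊆ W) (hcard : ∀ p ∈ S, (edge p).card = 2)
    (hdeg : ∀ w ∈ W, (S.filter fun p => w ∈ edge p).card ≤ 2) : S.card ≤ W.card := by
  have h1 : 2 * S.card = ∑ p ∈ S, (edge p).card := by
    rw [Finset.sum_congr rfl fun p hp => hcard p hp, Finset.sum_const, smul_eq_mul, mul_comm]
  have h2 : ∑ p ∈ S, (edge p).card = ∑ p ∈ S, ∑ w ∈ W, if w ∈ edge p then 1 else 0 := by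
    refine Finset.sum_congr rfl fun p hp => ?_
    rw [← Finset.card_filter]
    congr 1
    ext w
    simp only [Finset.mem_filter]
    exact ⟨fun h => ⟨hsub p hp h, h⟩, fun h => h.2⟩
  have h3 : (∑ p ∈ S, ∑ w ∈ W, if w ∈ edge p then 1 else 0) =
      ∑ w ∈ W, (S.filter fun p => w ∈ edge p).card := by
    rw [Finset.sum_comm]
    refine Finset.sum_congr rfl fun w _ => ?_
    rw [Finset.card_filter]
  have h4 : ∑ w ∈ W, (S.filter fun p => w ∈ edge p).card ≤ ∑ _w ∈ W, 2 := Finset.sum_le_sum hdeg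
  rw [Finset.sum_const, smul_eq_mul] at h4
  omega

/-- **STUB 2 of line `FrameRungTwo` (`stub_faceCount`), verbatim.**  Cross-free vertices of `conv X` (strictly
exposed in `X` by a functional under which no point of `Y₀ ∪ Y₁` lies higher) number at most
`2 (vert Y₀ + vert Y₁)`: such a vertex is a vertex of `conv (Y₀ ∪ Y₁)` or lies inside an edge of it, each edge
carries at most one, and a planar convex polygon has no more edges than vertices (at most two edges at a vertex). -/
theorem stub_faceCount (X Y₀ Y₁ : Set (Fin 2 → ℝ)) (hX : X.Finite) (hY₀ : Y₀.Finite) (hY₁ : Y₁.Finite)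
    (hXY : X ⊆ Y₀ ∪ Y₁) :
    {p : Fin 2 → ℝ | p ∈ Set.extremePoints ℝ (convexHull ℝ X) ∧
        ∃ l : (Fin 2 → ℝ) →ₗ[ℝ] ℝ, (∀ q ∈ X, q ≠ p → l q < l p) ∧ (∀ q ∈ Y₀ ∪ Y₁, l q ≤ l p)}.ncard
      ≤ 2 * ((Set.extremePoints ℝ (convexHull ℝ Y₀)).ncard
            + (Set.extremePoints ℝ (convexHull ℝ Y₁)).ncard) := by
  classical
  set Y := Y₀ ∪ Y₁ with hYdef
  have hY : Y.Finite := hY₀.union hY₁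
  set V := Set.extremePoints ℝ (convexHull ℝ Y) with hVdef
  set T := {p : Fin 2 → ℝ | p ∈ Set.extremePoints ℝ (convexHull ℝ X) ∧
        ∃ l : (Fin 2 → ℝ) →ₗ[ℝ] ℝ, (∀ q ∈ X, q ≠ p → l q < l p) ∧ (∀ q ∈ Y, l q ≤ l p)} with hTdef
  -- Step 0: vertices of the union hull are vertices of one of the two hulls
  have hV0fin : (Set.extremePoints ℝ (convexHull ℝ Y₀)).Finite := hY₀.subset extremePoints_convexHull_subset
  have hV1fin : (Set.extremePoints ℝ (convexHull ℝ Y₁)).Finite := hY₁.subset extremePoints_convexHull_subset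
  have hVfin : V.Finite := hY.subset extremePoints_convexHull_subset
  have hVsub : V ⊆ Set.extremePoints ℝ (convexHull ℝ Y₀) ∪ Set.extremePoints ℝ (convexHull ℝ Y₁) := by
    intro v hv
    rcases (extremePoints_convexHull_subset hv : v ∈ Y) with h | h
    · exact Or.inl (inter_extremePoints_subset_extremePoints_of_subset
        (convexHull_mono Set.subset_union_left) ⟨subset_convexHull ℝ _ h, hv⟩)
    · exact Or.inr (inter_extremePoints_subset_extremePoints_of_subset
        (convexHull_mono Set.subset_union_right) ⟨subset_convexHull ℝ _ h, hv⟩)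
  have hVcard : V.ncard ≤ (Set.extremePoints ℝ (convexHull ℝ Y₀)).ncard
      + (Set.extremePoints ℝ (convexHull ℝ Y₁)).ncard :=
    (Set.ncard_le_ncard hVsub (hV0fin.union hV1fin)).trans (Set.ncard_union_le _ _)
  suffices hmain : T.ncard ≤ V.ncard + V.ncard by
    have : T.ncard ≤ 2 * V.ncard := by omega
    exact this.trans (Nat.mul_le_mul_left 2 hVcard)
  have hTX : T ⊆ X := fun p hp => extremePoints_convexHull_subset hp.1
  have hTfin : T.Finite := hX.subset hTX
  have hsplit : T.ncard ≤ (T ∩ V).ncard + (T \ V).ncard := by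
    calc T.ncard = ((T ∩ V) ∪ (T \ V)).ncard := by rw [Set.inter_union_sdiff]
      _ ≤ (T ∩ V).ncard + (T \ V).ncard := Set.ncard_union_le _ _
  have h1 : (T ∩ V).ncard ≤ V.ncard := Set.ncard_le_ncard Set.inter_subset_right hVfin
  suffices h2 : (T \ V).ncard ≤ V.ncard by omega
  -- the degenerate case: `X` has at most one point
  by_cases hXs : X.Subsingleton
  · have hsub : (T \ V).Subsingleton := hXs.anti (Set.sdiff_subset.trans hTX)
    rcases (T \ V).eq_empty_or_nonempty with he | ⟨p, hp⟩
    · rw [he, Set.ncard_empty]; exact Nat.zero_le _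
    · have hle : (T \ V).ncard ≤ 1 := (Set.ncard_le_one (hTfin.subset Set.sdiff_subset)).mpr
        (fun a ha b hb => hsub ha hb)
      have hpY : p ∈ Y := hXY (hTX hp.1)
      have hVne : V.Nonempty :=
        (hY.isCompact_convexHull (𝕜 := ℝ)).extremePoints_nonempty ⟨p, subset_convexHull ℝ _ hpY⟩
      have : 1 ≤ V.ncard := (Set.ncard_pos hVfin).mpr hVne
      omega
  -- the main case: two distinct points of `X`
  obtain ⟨x₁, hx₁, x₂, hx₂, hx₁₂⟩ : ∃ x₁ ∈ X, ∃ x₂ ∈ X, x₁ ≠ x₂ := by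
    by_contra h
    push Not at h
    exact hXs fun a ha b hb => h a ha b hb
  set YF := hY.toFinset with hYF
  have hmemYF : ∀ y, y ∈ YF ↔ y ∈ Y := fun y => Set.Finite.mem_toFinset hY
  -- the KEY: every `p ∈ T \ V` comes with a form `(α, β) ≠ 0` and two distinct vertices `a, b` on its top face
  have key : ∀ p, p ∈ T \ V → ∃ α β : ℝ, ∃ a b : Fin 2 → ℝ,
      (α ≠ 0 ∨ β ≠ 0) ∧ (∀ q ∈ X, q ≠ p → α * q 0 + β * q 1 < α * p 0 + β * p 1) ∧
      (∀ q ∈ Y, α * q 0 + β * q 1 ≤ α * p 0 + β * p 1) ∧ a ∈ V ∧ b ∈ V ∧ a ≠ b ∧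
      α * a 0 + β * a 1 = α * p 0 + β * p 1 ∧ α * b 0 + β * b 1 = α * p 0 + β * p 1 := by
    rintro p ⟨hpT, hpV⟩
    obtain ⟨hpext, l, hl1, hl2⟩ := hpT
    set α := l (Pi.single 0 1) with hα
    set β := l (Pi.single 1 1) with hβ
    have hl : ∀ x, l x = α * x 0 + β * x 1 := lin_decomp l
    have hpX : p ∈ X := extremePoints_convexHull_subset hpext
    have hpY : p ∈ Y := hXY hpX
    -- (α, β) ≠ 0
    have hnz : α ≠ 0 ∨ β ≠ 0 := by
      by_contra h
      push Not at h
      obtain ⟨q, hq, hqp⟩ : ∃ q ∈ X, q ≠ p := by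
        by_cases h1 : x₁ = p
        · exact ⟨x₂, hx₂, fun h2 => hx₁₂ (h1.trans h2.symm)⟩
        · exact ⟨x₁, hx₁, h1⟩
      have := hl1 q hq hqp
      rw [hl, hl, h.1, h.2] at this
      simp at this
    -- the top face `M` and its two lexicographic extremes
    set M := YF.filter (fun y => α * y 0 + β * y 1 = α * p 0 + β * p 1) with hM
    have hpM : p ∈ M := Finset.mem_filter.mpr ⟨(hmemYF p).mpr hpY, rfl⟩
    have hMne : M.Nonempty := ⟨p, hpM⟩
    set g : (Fin 2 → ℝ) → ℝ := fun y => -β * y 0 + α * y 1 with hg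
    obtain ⟨a, haM, hamax⟩ := Finset.exists_max_image M g hMne
    obtain ⟨b, hbM, hbmin⟩ := Finset.exists_min_image M g hMne
    have haY : a ∈ YF := (Finset.mem_filter.mp haM).1
    have hbY : b ∈ YF := (Finset.mem_filter.mp hbM).1
    have hal : α * a 0 + β * a 1 = α * p 0 + β * p 1 := (Finset.mem_filter.mp haM).2
    have hbl : α * b 0 + β * b 1 = α * p 0 + β * p 1 := (Finset.mem_filter.mp hbM).2
    have hl2' : ∀ q ∈ Y, α * q 0 + β * q 1 ≤ α * p 0 + β * p 1 := by
      intro q hq; have := hl2 q hq; rwa [hl, hl] at this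
    have hYco : ((YF : Set (Fin 2 → ℝ))) = Y := Set.Finite.coe_toFinset hY
    -- a and b are vertices of `conv Y`
    have haV : a ∈ V := by
      rw [hVdef, ← hYco]
      refine lexmax_mem_extremePoints YF a haY α β 1 hnz (Or.inl rfl) (fun y hy => ?_) (fun y hy hyl => ?_)
      · rw [hal]; exact hl2' y ((hmemYF y).mp hy)
      · have hyM : y ∈ M := Finset.mem_filter.mpr ⟨hy, by rw [hyl, hal]⟩
        have := hamax y hyM
        simp only [hg] at this
        linarith
    have hbV : b ∈ V := by
      rw [hVdef, ← hYco]
      refine lexmax_mem_extremePoints YF b hbY α β (-1) hnz (Or.inr rfl) (fun y hy => ?_) (fun y hy hyl => ?_)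
      · rw [hbl]; exact hl2' y ((hmemYF y).mp hy)
      · have hyM : y ∈ M := Finset.mem_filter.mpr ⟨hy, by rw [hyl, hbl]⟩
        have := hbmin y hyM
        simp only [hg] at this
        linarith
    -- a ≠ b, for otherwise the face is the single point `p`, a vertex
    have hab : a ≠ b := by
      intro heq
      apply hpV
      have hpa : p = a := by
        have h1 := hamax p hpM
        have h2 := hbmin p hpM
        rw [← heq] at h2
        have hgeq : g p = g a := le_antisymm h1 h2
        simp only [hg] at hgeq
        have e1 : α * (p 0 - a 0) + β * (p 1 - a 1) = 0 := by linarith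
        have e2 : -β * (p 0 - a 0) + α * (p 1 - a 1) = 0 := by linarith
        obtain ⟨h0, h1'⟩ := eq_zero_of_form_and_rot α β _ _ hnz e1 e2
        funext i; fin_cases i
        · show p 0 = a 0; linarith
        · show p 1 = a 1; linarith
      rw [hpa]; exact haV
    exact ⟨α, β, a, b, hnz, fun q hq hqp => by have := hl1 q hq hqp; rwa [hl, hl] at this, hl2',
      haV, hbV, hab, hal, hbl⟩
  choose! αf βf af bf hnz hstrict hmax haV hbV hab hal hbl using key
  -- finsets
  set TBF := hX.toFinset.filter (fun p => p ∈ T ∧ p ∉ V) with hTBF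
  set VF := YF.filter (fun v => v ∈ V) with hVF
  have hmemTBF : ∀ p, p ∈ TBF ↔ p ∈ T \ V := by
    intro p
    simp only [hTBF, Finset.mem_filter, Set.Finite.mem_toFinset, Set.mem_sdiff]
    exact ⟨fun h => h.2, fun h => ⟨hTX h.1, h⟩⟩
  have hmemVF : ∀ v, v ∈ VF ↔ v ∈ V := by
    intro v
    simp only [hVF, Finset.mem_filter, hmemYF]
    exact ⟨fun h => h.2, fun h => ⟨extremePoints_convexHull_subset h, h⟩⟩
  have hTBco : (T \ V) = ↑TBF := by ext p; rw [Finset.mem_coe, hmemTBF]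
  have hVco : V = ↑VF := by ext v; rw [Finset.mem_coe, hmemVF]
  rw [hTBco, hVco, Set.ncard_coe_finset, Set.ncard_coe_finset]
  -- injectivity core: two cross-free points sharing a face pair coincide
  have inj : ∀ p p', p ∈ T \ V → p' ∈ T \ V → ∀ v c : Fin 2 → ℝ, v ≠ c →
      αf p * v 0 + βf p * v 1 = αf p * p 0 + βf p * p 1 →
      αf p * c 0 + βf p * c 1 = αf p * p 0 + βf p * p 1 →
      αf p' * v 0 + βf p' * v 1 = αf p' * p' 0 + βf p' * p' 1 →
      αf p' * c 0 + βf p' * c 1 = αf p' * p' 0 + βf p' * p' 1 → p = p' := by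
    intro p p' hp hp' v c hvc hv hc hv' hc'
    by_contra hne
    have hd : v 0 - c 0 ≠ 0 ∨ v 1 - c 1 ≠ 0 := by
      by_contra h
      push Not at h
      apply hvc
      funext i; fin_cases i
      · show v 0 = c 0; linarith [h.1]
      · show v 1 = c 1; linarith [h.2]
    have h1 : αf p * (v 0 - c 0) + βf p * (v 1 - c 1) = 0 := by linarith
    have h2 : αf p' * (v 0 - c 0) + βf p' * (v 1 - c 1) = 0 := by linarith
    have hw : αf p * (p 0 - v 0) + βf p * (p 1 - v 1) = 0 := by linarith
    have hw' := form_eq_zero_of_parallel _ _ _ _ _ _ _ _ (hnz p hp) hd h1 h2 hw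
    -- so `l_{p'} p = l_{p'} v = l_{p'} p'`, contradicting strict exposure of `p'`
    have hpX : p ∈ X := hTX hp.1
    have := hstrict p' hp' p hpX hne
    linarith
  -- edges
  let edge : (Fin 2 → ℝ) → Finset (Fin 2 → ℝ) := fun p => {af p, bf p}
  refine card_le_of_edges TBF VF edge (fun p hp => ?_) (fun p hp => ?_) (fun v hv => ?_)
  · have hp' := (hmemTBF p).mp hp
    intro x hx
    rcases Finset.mem_insert.mp hx with rfl | hx
    · exact (hmemVF _).mpr (haV p hp')
    · rw [Finset.mem_singleton] at hx; rw [hx]; exact (hmemVF _).mpr (hbV p hp')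
  · exact Finset.card_pair (hab p ((hmemTBF p).mp hp))
  · -- at most two cross-free points use the vertex `v`
    by_contra hgt
    push Not at hgt
    obtain ⟨p₁, p₂, p₃, hp₁, hp₂, hp₃, h12, h13, h23⟩ := Finset.two_lt_card_iff.mp hgt
    have hvV : v ∈ V := (hmemVF v).mp hv
    -- unpack: p_i ∈ T \ V and v ∈ edge p_i; the other endpoint c_i
    have unpack : ∀ p, p ∈ TBF.filter (fun p => v ∈ edge p) → p ∈ T \ V ∧ ∃ c, c ∈ V ∧ c ≠ v ∧
        αf p * v 0 + βf p * v 1 = αf p * p 0 + βf p * p 1 ∧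
        αf p * c 0 + βf p * c 1 = αf p * p 0 + βf p * p 1 := by
      intro p hp
      obtain ⟨hpT, hve⟩ := Finset.mem_filter.mp hp
      have hp' := (hmemTBF p).mp hpT
      refine ⟨hp', ?_⟩
      rcases Finset.mem_insert.mp hve with hva | hvb
      · exact ⟨bf p, hbV p hp', fun h => hab p hp' (hva.symm.trans h.symm),
          by rw [hva]; exact hal p hp', hbl p hp'⟩
      · rw [Finset.mem_singleton] at hvb
        exact ⟨af p, haV p hp', fun h => hab p hp' (h.trans hvb), by rw [hvb]; exact hbl p hp', hal p hp'⟩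
    obtain ⟨hq₁, c₁, hc₁V, hc₁v, hv₁, hc₁⟩ := unpack p₁ hp₁
    obtain ⟨hq₂, c₂, hc₂V, hc₂v, hv₂, hc₂⟩ := unpack p₂ hp₂
    obtain ⟨hq₃, c₃, hc₃V, hc₃v, hv₃, hc₃⟩ := unpack p₃ hp₃
    -- distinct other endpoints
    have hc₁₂ : c₁ ≠ c₂ := fun h => h12 (inj p₁ p₂ hq₁ hq₂ v c₁ hc₁v.symm hv₁ hc₁ hv₂ (h ▸ hc₂))
    have hc₁₃ : c₁ ≠ c₃ := fun h => h13 (inj p₁ p₃ hq₁ hq₃ v c₁ hc₁v.symm hv₁ hc₁ hv₃ (h ▸ hc₃))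
    have hc₂₃ : c₂ ≠ c₃ := fun h => h23 (inj p₂ p₃ hq₂ hq₃ v c₂ hc₂v.symm hv₂ hc₂ hv₃ (h ▸ hc₃))
    have hcY : ∀ c, c ∈ V → c ∈ Y := fun c hc => extremePoints_convexHull_subset hc
    -- non-parallel directions
    have nonpar : ∀ c c' : Fin 2 → ℝ, c ∈ V → c' ∈ V → c ≠ v → c' ≠ v → c ≠ c' →
        (c 0 - v 0) * (c' 1 - v 1) - (c 1 - v 1) * (c' 0 - v 0) ≠ 0 := by
      intro c c' hcV hc'V hcv hc'v hcc' hdet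
      have hd : c 0 - v 0 ≠ 0 ∨ c 1 - v 1 ≠ 0 := by
        by_contra h; push Not at h
        apply hcv; funext i; fin_cases i
        · show c 0 = v 0; linarith [h.1]
        · show c 1 = v 1; linarith [h.2]
      obtain ⟨μ, hμ0, hμ1⟩ := exists_smul_of_det_eq_zero _ _ _ _ hd hdet
      -- c' = v + μ (c - v)
      have hc'eq : ∀ i : Fin 2, c' i = v i + μ * (c i - v i) := by
        intro i; fin_cases i
        · show c' 0 = v 0 + μ * (c 0 - v 0); linarith
        · show c' 1 = v 1 + μ * (c 1 - v 1); linarith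
      rcases lt_trichotomy μ 0 with hμ | hμ | hμ
      · -- v strictly between c and c'
        have h1μ : (1 : ℝ) - μ ≠ 0 := by linarith
        refine not_mem_extremePoints_of_between (hcY c hcV) (hcY c' hc'V) hcc' (-μ / (1 - μ)) (1 / (1 - μ))
          (div_pos (by linarith) (by linarith)) (div_pos one_pos (by linarith))
          (by field_simp; ring) ?_ hvV
        funext i
        simp only [Pi.add_apply, Pi.smul_apply, smul_eq_mul, hc'eq i]
        field_simp
        ring
      · apply hc'v; funext i; rw [hc'eq i, hμ]; ring
      · rcases lt_trichotomy μ 1 with hμ1' | hμ1' | hμ1'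
        · -- c' strictly between v and c
          refine not_mem_extremePoints_of_between (hcY v hvV) (hcY c hcV) hcv.symm (1 - μ) μ (by linarith) hμ
            (by ring) ?_ hc'V
          funext i
          simp only [Pi.add_apply, Pi.smul_apply, smul_eq_mul, hc'eq i]
          ring
        · apply hcc'; funext i; rw [hc'eq i, hμ1']; ring
        · -- c strictly between v and c'
          refine not_mem_extremePoints_of_between (hcY v hvV) (hcY c' hc'V) hc'v.symm (1 - 1 / μ) (1 / μ)
            (by rw [sub_pos, div_lt_one hμ]; exact hμ1') (div_pos one_pos hμ) (by ring) ?_ hcV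
          funext i
          simp only [Pi.add_apply, Pi.smul_apply, smul_eq_mul, hc'eq i]
          field_simp
          ring
    -- the sign argument
    refine three_directions_absurd (αf p₁) (βf p₁) (αf p₂) (βf p₂) (αf p₃) (βf p₃)
      (c₁ 0 - v 0) (c₁ 1 - v 1) (c₂ 0 - v 0) (c₂ 1 - v 1) (c₃ 0 - v 0) (c₃ 1 - v 1)
      (hnz p₁ hq₁) (hnz p₂ hq₂) (hnz p₃ hq₃) ?_ ?_ ?_
      (nonpar c₁ c₂ hc₁V hc₂V hc₁v hc₂v hc₁₂) (nonpar c₁ c₃ hc₁V hc₃V hc₁v hc₃v hc₁₃)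
      (nonpar c₂ c₃ hc₂V hc₃V hc₂v hc₃v hc₂₃)
      (by linarith) (by linarith) (by linarith) ?_ ?_ ?_ ?_ ?_ ?_
    · by_contra h; push Not at h; apply hc₁v; funext i; fin_cases i
      · show c₁ 0 = v 0; linarith [h.1]
      · show c₁ 1 = v 1; linarith [h.2]
    · by_contra h; push Not at h; apply hc₂v; funext i; fin_cases i
      · show c₂ 0 = v 0; linarith [h.1]
      · show c₂ 1 = v 1; linarith [h.2]
    · by_contra h; push Not at h; apply hc₃v; funext i; fin_cases i
      · show c₃ 0 = v 0; linarith [h.1]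
      · show c₃ 1 = v 1; linarith [h.2]
    · linarith [hmax p₁ hq₁ c₂ (hcY c₂ hc₂V)]
    · linarith [hmax p₁ hq₁ c₃ (hcY c₃ hc₃V)]
    · linarith [hmax p₂ hq₂ c₁ (hcY c₁ hc₁V)]
    · linarith [hmax p₂ hq₂ c₃ (hcY c₃ hc₃V)]
    · linarith [hmax p₃ hq₃ c₁ (hcY c₁ hc₁V)]
    · linarith [hmax p₃ hq₃ c₂ (hcY c₂ hc₂V)]

end

end Summit.ValiantsHypothesis.ValiantsHypothesis.Theorems.NewtonFramesTwoProducts.FrameRungTwoFaceCount
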